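import Literature.Topology.FourManifolds.HurwitzDeletionCriterion
import HarnessLib

/-!
# Frozen central letters: a certificate of NON-nullity for the Hurwitz–deletion calculus

Topic `Literature/Topology/FourManifolds`; companion of `HurwitzDeletionCalculus.lean` and
`HurwitzDeletionCriterion.lean`.  Theorems only.

**The certificate** (`not_isHurwitzNull_of_frozen`).  Let `w` be a signed word and `x ∈ w` a letter
whose class `z = t_c^{ε}` COMMUTES with the class of every letter of `w` (so `z` is central in the
letter subgroup `H_w`; e.g. `c` is disjoint from every other vanishing cycle, or boundary-parallel
in a subsurface containing all of them) and such that NO letter of `w` has class `z⁻¹`.  Then `w` is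
not Hurwitz-null.  Reason: such a letter is FROZEN — along any sequence of moves some letter keeps
the class `z` (Hurwitz moves conjugate letters by elements of `H_w`, which fix `z`; global
conjugations transport everything), the class stays central (`H` is unchanged by Hurwitz moves,
conjugated by conjugations, and only shrinks at deletions), no letter of class `z⁻¹` is ever created
(every letter class is an `H`-conjugate of an old one, and `h z⁻¹ h⁻¹ = z⁻¹`), so the frozen letter is
never deleted — and a null word ends empty.  This is the formal form of the two "dead end"
certificates met by the genus-4 searches of the line `hurwitz-deletion-presentation` (crux
`ConvexBisection.AcyclicBisectionRigidity`, stmt-SmoothPoincare4-10507): a planar letter peripheral in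
the subsurface filled by the remaining letters can never be deleted.

## References

* D. Auroux, *A stable classification of Lefschetz fibrations*, Geom. Topol. 9 (2005), §2. [Auroux2005]
* B. Farb, D. Margalit, *A Primer on Mapping Class Groups* (2012), Fact 3.7, §3.5. [FarbMargalit2012]
-/

open scoped Manifold ContDiff Topology
open Set Function

noncomputable section

namespace Literature.Topology.FourManifolds

section Frozen

variable {P : Type*} [TopologicalSpace P] [T2Space P] [ChartedSpace (EuclideanHalfSpace 2) P]
  [IsManifold (𝓡∂ 2) ∞ P] {o : SmoothOrientation (𝓡∂ 2) P}

/-! ### Sign-aware conjugation bookkeeping for Hurwitz steps -/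

/-- After a Hurwitz step every letter is, WITH ITS SIGN, an `H_w`-conjugate of an old letter.
[cite: Auroux2005, §2] -/
theorem HurwitzStep.exists_conj_of_mem_sign {w w' : List (Letter P o)} (h : HurwitzStep w w')
    {z : Letter P o} (hz : z ∈ w') :
    ∃ t ∈ w, t.2 = z.2 ∧ ∃ u ∈ Subgroup.closure {c | ∃ x ∈ w, c = Letter.toClass x},
      z.toClass = u * t.toClass * u⁻¹ := by
  obtain ⟨pre, suf, x, y, rfl, rfl | rfl⟩ := h
  · simp only [List.mem_append, List.mem_cons] at hz
    rcases hz with hz | rfl | rfl | hz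
    · exact ⟨z, by simp [hz], rfl, 1, one_mem _, by group⟩
    · exact ⟨y, by simp, rfl, x.toClass, Subgroup.subset_closure ⟨x, by simp, rfl⟩, Letter.toClass_act x y⟩
    · exact ⟨z, by simp, rfl, 1, one_mem _, by group⟩
    · exact ⟨z, by simp [hz], rfl, 1, one_mem _, by group⟩
  · simp only [List.mem_append, List.mem_cons] at hz
    rcases hz with hz | rfl | rfl | hz
    · exact ⟨z, by simp [hz], rfl, 1, one_mem _, by group⟩
    · exact ⟨z, by simp, rfl, 1, one_mem _, by group⟩
    · refine ⟨x, by simp, rfl, y.toClass⁻¹,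
        Subgroup.inv_mem _ (Subgroup.subset_closure ⟨y, by simp, rfl⟩), ?_⟩
      rw [Letter.toClass_act, Letter.toClass_inv]
    · exact ⟨z, by simp [hz], rfl, 1, one_mem _, by group⟩

/-- Before a Hurwitz step every letter is, WITH ITS SIGN, an `H_{w'}`-conjugate of a new letter.
[cite: Auroux2005, §2] -/
theorem HurwitzStep.exists_conj_of_mem_sign' {w w' : List (Letter P o)} (h : HurwitzStep w w')
    {z : Letter P o} (hz : z ∈ w) :
    ∃ t ∈ w', t.2 = z.2 ∧ ∃ u ∈ Subgroup.closure {c | ∃ x ∈ w', c = Letter.toClass x},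
      z.toClass = u * t.toClass * u⁻¹ := by
  obtain ⟨pre, suf, x, y, rfl, rfl | rfl⟩ := h
  · simp only [List.mem_append, List.mem_cons] at hz
    rcases hz with hz | rfl | rfl | hz
    · exact ⟨z, by simp [hz], rfl, 1, one_mem _, by group⟩
    · exact ⟨z, by simp, rfl, 1, one_mem _, by group⟩
    · refine ⟨(x.act z.1, z.2), by simp, rfl, x.toClass⁻¹,
        Subgroup.inv_mem _ (Subgroup.subset_closure ⟨x, by simp, rfl⟩), ?_⟩
      rw [Letter.toClass_act]; group
    · exact ⟨z, by simp [hz], rfl, 1, one_mem _, by group⟩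
  · simp only [List.mem_append, List.mem_cons] at hz
    rcases hz with hz | rfl | rfl | hz
    · exact ⟨z, by simp [hz], rfl, 1, one_mem _, by group⟩
    · refine ⟨(y.inv.act z.1, z.2), by simp, rfl, y.toClass, Subgroup.subset_closure ⟨y, by simp, rfl⟩, ?_⟩
      rw [Letter.toClass_act, Letter.toClass_inv]; group
    · exact ⟨z, by simp, rfl, 1, one_mem _, by group⟩
    · exact ⟨z, by simp [hz], rfl, 1, one_mem _, by group⟩

/-! ### The invariant and its transfer -/

/-- Commuting with every letter class means centralising the whole letter subgroup. [folklore] -/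
theorem closure_le_centralizer_of_forall_comm {w : List (Letter P o)}
    {z : MappingClassGroupRelBoundary (𝓡∂ 2) P}
    (hz : ∀ y ∈ w, z * y.toClass = y.toClass * z) :
    Subgroup.closure {c | ∃ x ∈ w, c = Letter.toClass x} ≤ Subgroup.centralizer {z} := by
  refine (Subgroup.closure_le _).2 ?_
  rintro c ⟨x, hx, rfl⟩
  rw [SetLike.mem_coe, Subgroup.mem_centralizer_iff]
  rintro g rfl
  exact hz x hx

/-- **Transfer of the frozen-letter invariant** along a step whose letters are signed
`H`-conjugates of each other in both directions with the same letter subgroup (Hurwitz steps,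
either way). [folklore] -/
theorem frozen_transfer {w w' : List (Letter P o)}
    (hfwd : ∀ z ∈ w', ∃ t ∈ w, t.2 = z.2 ∧ ∃ u ∈ Subgroup.closure {c | ∃ x ∈ w, c = Letter.toClass x},
      z.toClass = u * t.toClass * u⁻¹)
    (hbwd : ∀ z ∈ w, ∃ t ∈ w', t.2 = z.2 ∧ ∃ u ∈ Subgroup.closure {c | ∃ x ∈ w, c = Letter.toClass x},
      z.toClass = u * t.toClass * u⁻¹)
    (h : ∃ x ∈ w, (∀ y ∈ w, x.toClass * y.toClass = y.toClass * x.toClass) ∧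
      ∀ y ∈ w, y.toClass ≠ x.toClass⁻¹) :
    ∃ x ∈ w', (∀ y ∈ w', x.toClass * y.toClass = y.toClass * x.toClass) ∧
      ∀ y ∈ w', y.toClass ≠ x.toClass⁻¹ := by
  obtain ⟨x, hx, hcomm, hnp⟩ := h
  have hcen := closure_le_centralizer_of_forall_comm hcomm
  have hzcen : ∀ u ∈ Subgroup.closure {c | ∃ x ∈ w, c = Letter.toClass x},
      u * x.toClass = x.toClass * u := fun u hu => by
    have := hcen hu
    rw [Subgroup.mem_centralizer_iff] at this
    exact (this x.toClass rfl).symm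
  obtain ⟨x', hx', hsign, u, hu, hxu⟩ := hbwd x hx
  -- x'.toClass = x.toClass
  have hx'c : x'.toClass = x.toClass := by
    have h1 := hzcen u hu
    calc x'.toClass = u⁻¹ * (u * x'.toClass * u⁻¹) * u := by group
      _ = u⁻¹ * x.toClass * u := by rw [← hxu]
      _ = u⁻¹ * (x.toClass * u) := by group
      _ = u⁻¹ * (u * x.toClass) := by rw [h1]
      _ = x.toClass := by group
  refine ⟨x', hx', ?_, ?_⟩
  · intro y' hy'
    obtain ⟨m, hm, -, k, hk, hyk⟩ := hfwd y' hy'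
    rw [hx'c, hyk]
    have h1 := hzcen k hk
    have h2 := hcomm m hm
    calc x.toClass * (k * m.toClass * k⁻¹) = (x.toClass * k) * m.toClass * k⁻¹ := by group
      _ = (k * x.toClass) * m.toClass * k⁻¹ := by rw [h1]
      _ = k * (x.toClass * m.toClass) * k⁻¹ := by group
      _ = k * (m.toClass * x.toClass) * k⁻¹ := by rw [h2]
      _ = k * m.toClass * (x.toClass * k⁻¹) := by group
      _ = k * m.toClass * (k⁻¹ * x.toClass) := by
          congr 1
          calc x.toClass * k⁻¹ = k⁻¹ * (k * x.toClass) * k⁻¹ := by group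
            _ = k⁻¹ * (x.toClass * k) * k⁻¹ := by rw [h1]
            _ = k⁻¹ * x.toClass := by group
      _ = k * m.toClass * k⁻¹ * x.toClass := by group
  · intro y' hy' heq
    obtain ⟨m, hm, -, k, hk, hyk⟩ := hfwd y' hy'
    apply hnp m hm
    rw [hx'c] at heq
    rw [heq] at hyk
    -- x⁻¹ = k m k⁻¹ ⇒ m = k⁻¹ x⁻¹ k = x⁻¹
    have h1 := hzcen k hk
    calc m.toClass = k⁻¹ * (k * m.toClass * k⁻¹) * k := by group
      _ = k⁻¹ * x.toClass⁻¹ * k := by rw [← hyk]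
      _ = x.toClass⁻¹ := by
          calc k⁻¹ * x.toClass⁻¹ * k = (x.toClass * k)⁻¹ * k := by group
            _ = (k * x.toClass)⁻¹ * k := by rw [h1]
            _ = x.toClass⁻¹ := by group

/-- **Transfer along a global conjugation** (push forward by `g`). [cite: Auroux2005, §2] -/
theorem frozen_conjWord (g : DiffRelBoundary (𝓡∂ 2) P)
    (hg : g ∈ RelDiffeo.orientedSubgroup ((𝓡∂ 2).boundary P) o) {w : List (Letter P o)}
    (h : ∃ x ∈ w, (∀ y ∈ w, x.toClass * y.toClass = y.toClass * x.toClass) ∧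
      ∀ y ∈ w, y.toClass ≠ x.toClass⁻¹) :
    ∃ x ∈ conjWord g hg w, (∀ y ∈ conjWord g hg w, x.toClass * y.toClass = y.toClass * x.toClass) ∧
      ∀ y ∈ conjWord g hg w, y.toClass ≠ x.toClass⁻¹ := by
  obtain ⟨x, hx, hcomm, hnp⟩ := h
  refine ⟨(x.1.mapRel g hg, x.2), (mem_conjWord_iff g hg w _).2 ⟨x, hx, rfl⟩, ?_, ?_⟩
  · intro y hy
    obtain ⟨y₀, hy₀, rfl⟩ := (mem_conjWord_iff g hg w y).1 hy
    rw [Letter.toClass_mapRel, Letter.toClass_mapRel]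
    have := hcomm y₀ hy₀
    calc _ = MappingClassGroup.mk _ _ _ g * (x.toClass * y₀.toClass) * (MappingClassGroup.mk _ _ _ g)⁻¹ := by
            group
      _ = MappingClassGroup.mk _ _ _ g * (y₀.toClass * x.toClass) * (MappingClassGroup.mk _ _ _ g)⁻¹ := by
            rw [this]
      _ = _ := by group
  · intro y hy heq
    obtain ⟨y₀, hy₀, rfl⟩ := (mem_conjWord_iff g hg w y).1 hy
    rw [Letter.toClass_mapRel, Letter.toClass_mapRel] at heq
    apply hnp y₀ hy₀
    set γ := MappingClassGroup.mk _ _ _ g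
    calc y₀.toClass = γ⁻¹ * (γ * y₀.toClass * γ⁻¹) * γ := by group
      _ = γ⁻¹ * (γ * x.toClass * γ⁻¹)⁻¹ * γ := by rw [heq]
      _ = x.toClass⁻¹ := by group

/-- **Transfer along a global conjugation, backwards** (the word `w` is `conjWord g w'`). [cite: Auroux2005, §2] -/
theorem frozen_of_conjWord (g : DiffRelBoundary (𝓡∂ 2) P)
    (hg : g ∈ RelDiffeo.orientedSubgroup ((𝓡∂ 2).boundary P) o) {w' : List (Letter P o)}
    (h : ∃ x ∈ conjWord g hg w', (∀ y ∈ conjWord g hg w', x.toClass * y.toClass = y.toClass * x.toClass) ∧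
      ∀ y ∈ conjWord g hg w', y.toClass ≠ x.toClass⁻¹) :
    ∃ x ∈ w', (∀ y ∈ w', x.toClass * y.toClass = y.toClass * x.toClass) ∧
      ∀ y ∈ w', y.toClass ≠ x.toClass⁻¹ := by
  obtain ⟨x, hx, hcomm, hnp⟩ := h
  obtain ⟨x₀, hx₀, rfl⟩ := (mem_conjWord_iff g hg w' x).1 hx
  refine ⟨x₀, hx₀, ?_, ?_⟩
  · intro y hy
    have hc := hcomm (y.1.mapRel g hg, y.2) ((mem_conjWord_iff g hg w' _).2 ⟨y, hy, rfl⟩)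
    rw [Letter.toClass_mapRel, Letter.toClass_mapRel] at hc
    set γ := MappingClassGroup.mk _ _ _ g
    have hc' : γ * (x₀.toClass * y.toClass) * γ⁻¹ = γ * (y.toClass * x₀.toClass) * γ⁻¹ := by
      calc γ * (x₀.toClass * y.toClass) * γ⁻¹ = γ * x₀.toClass * γ⁻¹ * (γ * y.toClass * γ⁻¹) := by group
        _ = γ * y.toClass * γ⁻¹ * (γ * x₀.toClass * γ⁻¹) := hc
        _ = γ * (y.toClass * x₀.toClass) * γ⁻¹ := by group
    calc x₀.toClass * y.toClass = γ⁻¹ * (γ * (x₀.toClass * y.toClass) * γ⁻¹) * γ := by group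
      _ = γ⁻¹ * (γ * (y.toClass * x₀.toClass) * γ⁻¹) * γ := by rw [hc']
      _ = y.toClass * x₀.toClass := by group
  · intro y hy heq
    apply hnp (y.1.mapRel g hg, y.2) ((mem_conjWord_iff g hg w' _).2 ⟨y, hy, rfl⟩)
    rw [Letter.toClass_mapRel, Letter.toClass_mapRel, heq]
    group

/-- **Transfer along a deletion**: the frozen letter is not one of the deleted pair (their classes
are mutually inverse), and the invariant descends to the sublist. [folklore] -/
theorem Deletion.frozen {w w' : List (Letter P o)} (hd : Deletion w w')
    (h : ∃ x ∈ w, (∀ y ∈ w, x.toClass * y.toClass = y.toClass * x.toClass) ∧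
      ∀ y ∈ w, y.toClass ≠ x.toClass⁻¹) :
    ∃ x ∈ w', (∀ y ∈ w', x.toClass * y.toClass = y.toClass * x.toClass) ∧
      ∀ y ∈ w', y.toClass ≠ x.toClass⁻¹ := by
  obtain ⟨pre, suf, c, d, ε, rfl, hcd, rfl⟩ := hd
  obtain ⟨x, hx, hcomm, hnp⟩ := h
  have hsub : ∀ y ∈ pre ++ suf, y ∈ pre ++ (c, ε) :: (d, !ε) :: suf := by
    intro y hy
    simp only [List.mem_append, List.mem_cons] at hy ⊢
    rcases hy with hy | hy
    · exact Or.inl hy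
    · exact Or.inr (Or.inr (Or.inr hy))
  have hinv : ∀ η : Bool, Letter.toClass (d, !η) = (Letter.toClass (c, η))⁻¹ := by
    intro η
    cases η <;> simp [Letter.toClass_true, Letter.toClass_false, hcd]
  have hx' : x ∈ pre ++ suf := by
    simp only [List.mem_append, List.mem_cons] at hx
    rcases hx with hx | rfl | rfl | hx
    · exact List.mem_append.2 (Or.inl hx)
    · exact (hnp (d, !ε) (by simp) (hinv ε)).elim
    · exfalso
      refine hnp (c, ε) (by simp) ?_
      rw [hinv ε, inv_inv]
    · exact List.mem_append.2 (Or.inr hx)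
  exact ⟨x, hx', fun y hy => hcomm y (hsub y hy), fun y hy => hnp y (hsub y hy)⟩

/-- **One null step preserves the frozen-letter invariant.** [folklore] -/
theorem NullStep.frozen {w w' : List (Letter P o)} (hs : NullStep w w')
    (h : ∃ x ∈ w, (∀ y ∈ w, x.toClass * y.toClass = y.toClass * x.toClass) ∧
      ∀ y ∈ w, y.toClass ≠ x.toClass⁻¹) :
    ∃ x ∈ w', (∀ y ∈ w', x.toClass * y.toClass = y.toClass * x.toClass) ∧
      ∀ y ∈ w', y.toClass ≠ x.toClass⁻¹ := by
  rcases hs with hm | hm | hd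
  · cases hm with
    | hurwitz hst =>
      exact frozen_transfer (fun z hz => hst.exists_conj_of_mem_sign hz)
        (fun z hz => by
          obtain ⟨t, ht, hts, u, hu, heq⟩ := hst.exists_conj_of_mem_sign' hz
          rw [hst.closure_toClass_eq] at hu
          exact ⟨t, ht, hts, u, hu, heq⟩) h
    | conj g hg w => exact frozen_conjWord g hg h
  · cases hm with
    | hurwitz hst =>
      -- `w` is obtained from `w'` by the step `hst : HurwitzStep w' w`
      -- letters of w' are H_w-conjugates of letters of w (H_w = H_{w'}), and conversely
      exact frozen_transfer
        (fun z hz => by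
          obtain ⟨t, ht, hts, u, hu, heq⟩ := hst.exists_conj_of_mem_sign' hz
          exact ⟨t, ht, hts, u, hu, heq⟩)
        (fun z hz => by
          obtain ⟨t, ht, hts, u, hu, heq⟩ := hst.exists_conj_of_mem_sign hz
          rw [← hst.closure_toClass_eq] at hu
          exact ⟨t, ht, hts, u, hu, heq⟩) h
    | conj g hg w' => exact frozen_of_conjWord g hg h
  · exact hd.frozen h

/-- **FROZEN CENTRAL LETTERS CERTIFY NON-NULLITY.**  If some letter `x` of `w` has a class that
commutes with the class of every letter of `w` and no letter of `w` has the inverse class, then `w`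
is not Hurwitz-null.  Typical use: `x = (c, ε)` with `c` disjoint from (or peripheral to the
subsurface filled by) every other vanishing cycle, and no `(c, ¬ε)` present. [cite: FarbMargalit2012, Fact 3.7] -/
theorem not_isHurwitzNull_of_frozen {w : List (Letter P o)} {x : Letter P o} (hx : x ∈ w)
    (hcomm : ∀ y ∈ w, x.toClass * y.toClass = y.toClass * x.toClass)
    (hnp : ∀ y ∈ w, y.toClass ≠ x.toClass⁻¹) : ¬ IsHurwitzNull w := by
  intro hn
  have key : ∀ v : List (Letter P o), Relation.ReflTransGen NullStep v [] →
      (∃ x ∈ v, (∀ y ∈ v, x.toClass * y.toClass = y.toClass * x.toClass) ∧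
        ∀ y ∈ v, y.toClass ≠ x.toClass⁻¹) → False := by
    intro v hv
    induction hv using Relation.ReflTransGen.head_induction_on with
    | refl => rintro ⟨x, hx, -, -⟩; simp at hx
    | head hst _ ih => exact fun hI => ih (hst.frozen hI)
  exact key w hn ⟨x, hx, hcomm, hnp⟩

end Frozen

end Literature.Topology.FourManifolds

end
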